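import Mathlib

/-!
# Route OverlapGapAlgebra, crux `SolvableImpliesStableSection` (stmt-PneNP-2463), line `Sketch`:
# Stub 2 `stub_badPairs_le` — bad pairs in one direction (union bound + resampling involution)

On the product space `J → S` (coordinates `J`, symbols `S`) an edge of direction `j` joins `v` and
`Function.update v j s` with `s ≠ v j`.  A pair is *bad* when an endpoint lies outside the good set
`InG` or the step is a `D`-jump: `Bad v w ↔ ¬ InG v ∨ ¬ InG w ∨ D v w`.  We prove the per-direction
union bound

  `#{(v,s) : s ≠ v j ∧ Bad v (v[j ↦ s])} ≤ 2 · (|S| − 1) · #{v : ¬ InG v} + #{(v,s) : D v (v[j ↦ s])}`.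

Proof: split the bad set by `hBad` into three sets.  `A₁ = {(v,s) : s ≠ v j ∧ ¬ InG v}` is covered
by the union over `v ∉ InG` of the fibres `{v} × (univ.erase (v j))`, each of size `|S| − 1`, whence
`#A₁ ≤ (|S| − 1) · #{v : ¬ InG v}`.  `A₂ = {(v,s) : s ≠ v j ∧ ¬ InG (v[j ↦ s])}` is contained in the
image of `A₁` under the resampling involution `(v, s) ↦ (v[j ↦ s], v j)`, so `#A₂ ≤ #A₁`.  The third
set is `{(v,s) : D v (v[j ↦ s])}` itself.  Conclude with `Finset.card_union_le`.

Source of the setting: Bresler–Huang, arXiv:2106.02129, §6.2 (lazy coordinate-resampling walk on a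
product space, Lemma 6.5); the count itself is elementary.
-/

set_option linter.dupNamespace false

namespace Summit.PneNP.PneNP.Cruxes.SolvableImpliesStableSection.Sketch

open Finset
open scoped Classical

/-- **Stub 2 — bad pairs in one direction.**  For a fixed direction `j`, the number of pairs
`(v, s)` with `s ≠ v j` whose edge `v — v[j ↦ s]` is bad (`Bad v w ↔ ¬ InG v ∨ ¬ InG w ∨ D v w`) is at
most `2 · (|S| − 1) · #{v : ¬ InG v} + #{(v, s) : D v (v[j ↦ s])}` (union bound; the second endpoint
is handled by the resampling involution `(v, s) ↦ (v[j ↦ s], v j)`). -/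
theorem stub_badPairs_le {S J : Type*} [Fintype S] [Fintype J] [DecidableEq S] [DecidableEq J]
    (InG : (J → S) → Prop) (D Bad : (J → S) → (J → S) → Prop)
    (hBad : ∀ v w, Bad v w ↔ (¬ InG v ∨ ¬ InG w ∨ D v w)) (j : J) :
    ((univ : Finset ((J → S) × S)).filter fun p =>
        p.2 ≠ p.1 j ∧ Bad p.1 (Function.update p.1 j p.2)).card
      ≤ 2 * ((Fintype.card S - 1) * ((univ : Finset (J → S)).filter fun v => ¬ InG v).card)
        + ((univ : Finset ((J → S) × S)).filter fun p => D p.1 (Function.update p.1 j p.2)).card := by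
  set N := (univ : Finset (J → S)).filter fun v => ¬ InG v with hN
  set A₁ := (univ : Finset ((J → S) × S)).filter fun p => p.2 ≠ p.1 j ∧ ¬ InG p.1 with hA₁
  set A₂ := (univ : Finset ((J → S) × S)).filter fun p =>
    p.2 ≠ p.1 j ∧ ¬ InG (Function.update p.1 j p.2) with hA₂
  set A₃ := (univ : Finset ((J → S) × S)).filter fun p =>
    D p.1 (Function.update p.1 j p.2) with hA₃
  -- the bad set is covered by `A₁ ∪ A₂ ∪ A₃`
  have hsub : ((univ : Finset ((J → S) × S)).filter fun p =>
      p.2 ≠ p.1 j ∧ Bad p.1 (Function.update p.1 j p.2)) ⊆ A₁ ∪ A₂ ∪ A₃ := by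
    intro p hp
    simp only [mem_filter, mem_univ, true_and] at hp
    simp only [hA₁, hA₂, hA₃, mem_union, mem_filter, mem_univ, true_and]
    obtain ⟨hne, hb⟩ := hp
    rcases (hBad _ _).1 hb with h | h | h
    · exact Or.inl (Or.inl ⟨hne, h⟩)
    · exact Or.inl (Or.inr ⟨hne, h⟩)
    · exact Or.inr h
  -- `#A₁ ≤ (|S| - 1) · #N`: fibre over `v ∉ InG` is `univ.erase (v j)`
  have hA₁card : A₁.card ≤ (Fintype.card S - 1) * N.card := by
    have hcover : A₁ ⊆ N.biUnion fun v => (univ.erase (v j)).image fun s => (v, s) := by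
      intro p hp
      simp only [hA₁, mem_filter, mem_univ, true_and] at hp
      simp only [hN, mem_biUnion, mem_filter, mem_univ, true_and, mem_image, mem_erase]
      exact ⟨p.1, hp.2, p.2, ⟨hp.1, trivial⟩, rfl⟩
    calc A₁.card ≤ (N.biUnion fun v => (univ.erase (v j)).image fun s => (v, s)).card :=
          card_le_card hcover
      _ ≤ ∑ v ∈ N, ((univ.erase (v j)).image fun s => (v, s)).card := card_biUnion_le
      _ ≤ ∑ v ∈ N, (Fintype.card S - 1) := by
          refine sum_le_sum fun v _ => ?_
          calc ((univ.erase (v j)).image fun s => (v, s)).card ≤ (univ.erase (v j)).card :=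
                card_image_le
            _ = Fintype.card S - 1 := by rw [card_erase_of_mem (mem_univ _), card_univ]
      _ = (Fintype.card S - 1) * N.card := by rw [sum_const, smul_eq_mul, Nat.mul_comm]
  -- `#A₂ ≤ #A₁` via the resampling involution `(v, s) ↦ (v[j ↦ s], v j)`
  have hA₂card : A₂.card ≤ A₁.card := by
    have hcover : A₂ ⊆ A₁.image fun p => (Function.update p.1 j p.2, p.1 j) := by
      intro p hp
      simp only [hA₂, mem_filter, mem_univ, true_and] at hp
      simp only [hA₁, mem_image, mem_filter, mem_univ, true_and]
      refine ⟨(Function.update p.1 j p.2, p.1 j), ⟨?_, hp.2⟩, ?_⟩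
      · show p.1 j ≠ Function.update p.1 j p.2 j
        rw [Function.update_self]
        exact fun h => hp.1 h.symm
      · show (Function.update (Function.update p.1 j p.2) j (p.1 j),
          Function.update p.1 j p.2 j) = p
        rw [Function.update_idem, Function.update_eq_self, Function.update_self]
    exact (card_le_card hcover).trans card_image_le
  calc ((univ : Finset ((J → S) × S)).filter fun p =>
          p.2 ≠ p.1 j ∧ Bad p.1 (Function.update p.1 j p.2)).card
        ≤ (A₁ ∪ A₂ ∪ A₃).card := card_le_card hsub
    _ ≤ (A₁ ∪ A₂).card + A₃.card := card_union_le _ _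
    _ ≤ A₁.card + A₂.card + A₃.card := Nat.add_le_add_right (card_union_le _ _) _
    _ ≤ 2 * ((Fintype.card S - 1) * N.card) + A₃.card := by omega

end Summit.PneNP.PneNP.Cruxes.SolvableImpliesStableSection.Sketch
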